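import Literature.IUT.HodgeTheaters.GenuineFKitOfBadLocalTemperedSideNV
import Literature.AnabelianGeometry.EtaleTheta.TemperedFrobenioidOfThetaTwistTower
import Literature.AnabelianGeometry.EtaleTheta.Discharge.Sec3Remark363
import Literature.AlgebraicGeometry.Frobenioids.MonoidsTorsionFreeCharInjective
import HarnessLib

/-!
# [IUTchI] Example 3.2 tempered side `TemperedThetaInput` with the `ℱ̲_v`-summand an [EtTh] Def. 3.6 (ii) tempered
# Frobenioid CATEGORY (the ε-free theta tower, FILE 4, read at one covering through a constant re-basing over `𝒟_v`)
# — a MODEL (class (b)); `TemperedFrobenioid.constRebase`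

S. Mochizuki, *The étale theta function …*, Publ. RIMS **45** (2009) [MochizukiEtTh2009], Def. 3.6 (ii) p.303 (PDF p.77)
(«a connected, totally epimorphic category `D`, equipped with a functor `D → D₀`; `Φ ⊆ Φ^{ℝ-log} := Φ₀^ℝ|_D` …»),
Def. 3.6 (iv) p.304 («a natural faithful functor `C^{bs-fld} → C`») [cite: MochizukiEtTh2009, Def 3.6 p.77]; *Inter-universal
Teichmüller theory I*, Example 3.2 (i)–(v) pp.69–73 («a tempered Frobenioid `ℱ̲_v` … over a base category `𝒟_v`», «`T_(−)`»,
«`ℱ÷_v`», «`𝒞_v ⊆ ℱ̲_v`», «`𝒞⊢_v`», «`𝒞^Θ_v`») [claim: Mochizuki2012, status: disputed] (D-0012 claim key; nothing of the series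
is asserted; no side taken on [IUTchIII] Cor. 3.12).

abc-iut cell, seat abc-iut-L2-t6 gen 13 (layer L2 [EtTh]); row «THETA-INPUT@THETA-TOWER» = the suppliable down-scoping (F-c) of
L5-lead's bridge ask «THETA-REST@THETA-TOWER» (L2 ROWS R1189; L5 RULINGS #125 (1) GO): abc-iut-L5-t3's (m1) MODEL `sumModel`
(`GenuineFKitOfBadLocalTemperedSideNV.lean`: carriers `𝒟_v ⊕ (𝒞⊢_v ⊕ 𝒞^Θ_v)`) with its bare `𝒟_v`-summand REPLACED by the model
category of a genuine [EtTh] Def. 3.6 (ii) tempered Frobenioid over `𝒟_v`.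

* §1 **`TemperedFrobenioid.constRebase C A₀ D' …`** — for ANY tempered Frobenioid `C` over `D → D₀` (tree vocabulary on `D`), an
  object `A₀ ∈ Ob(D)` and ANY connected totally epimorphic `D'`: the Def. 3.6 (ii) datum over `D'` with the CONSTANT structure
  functor `D' → D₀`, `A' ↦ Y_{A₀}`, and `Φ(A') := Φ(A₀)` at every `A'` (pull-backs = identities; every clause of Def. 3.6 (ii)
  inherited from `C` at `A₀`; «divisorial monoid on `D'`» PROVED: identities are characteristically injective bijections);
  `constRebase_Φ_carrier`, `constRebase_bsFld_carrier` (the divisor data at every object ARE those of `C` at `A₀`).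
* §2 (private bookkeeping: a sum of faithful functors is faithful).
* §3 **`ThetaInputOfThetaTower.model T hq R S A₀ : TemperedThetaInput d T hq _ _ _`** for EVERY bad-place group datum `T`, every
  non-unit `q̲` and every covering `A₀` of the ε-free theta tower (FILE 4, abc-iut-L2-d2/L2-t3
  `ThetaTwistTowerTempered.temperedFrobenioid R S`): `ℱ̲_v = ℱ÷_v := C_{A₀}.category ⊕ (𝒞⊢_v ⊕ 𝒞^Θ_v)` with
  `C_{A₀} := (FILE 4).constRebase A₀ 𝒟_v`, `T_A := inl (A, 0)` (total over `𝒟_v`, lying over `A` ON THE NOSE),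
  `𝒞_v := C_{A₀}^{bs-fld} ⊕ 𝒞⊢_v` with `𝒞_v → ℱ̲_v :=` the REAL hull functor `⊕` the summand inclusion (faithful:
  `hullFaithful_holds` ⊕ inclusion), `𝒞⊢_v → 𝒞_v := inr`, `𝒞^Θ_v → ℱ÷_v := inr ∘ inr`, `birat := 𝟭`; `Θ̲_v := 1`,
  `𝒪^×(T^÷_Ÿ) := ⊥`, `l·ℤ := ⊥`, constants `:= 1`; §4 honesty/content lemmas: `model_theta`, `model_Tobj`,
  **`model_exists_mem_Φ_not_mem_bsFld`** (at EVERY object of `𝒟_v` the `ℱ̲_v`-summand's divisor monoid strictly contains its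
  base-field-theoretic part — the class of the zero divisor of `Θ̈`, FILE 4's `exists_mem_Φ_not_mem_bsFld`), `nonempty_model`.

WHY ONLY THIS (abc-iut-L2-t6 sizing 2026-08-27T05:38Z, booked as sub-gaps (a)/(b) of G-L5-EX32I-1): the stronger interface
`TemperedThetaRest` FORCES `𝒞_v := C.hullCategory` and asks for a FAITHFUL `𝒞⊢_v → 𝒞_v`; at every tower model of record the
Hom-torsors of the hull are torsors under a countable group of recorded roots of unity while those of `𝒞⊢_v` are torsors under
`O^×(Ω^U)` (cardinality `≥ 𝔠`) — unsatisfiable; and `Θ̲_v ∈ 𝒪^×(T^÷_Ÿ)` with `Θ̈`-content needs the birationalization functor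
`ℱ̲_v → ℱ̲_v^birat` ([FrdI] Prop. 4.4), not in the tree.  LABEL (travels with every use): «MODEL tempered side: the
`ℱ̲_v`/`𝒞_v`-summands are a genuine [EtTh] Def. 3.6 (ii) category and its base-field-theoretic hull (ε-free theta tower at one
covering, constant over `𝒟_v`); `𝒞⊢_v`, `𝒞^Θ_v` formal summands; `Θ̲_v`, `l·ℤ`, `𝒪^×(T^÷_Ÿ)`, constants TRIVIAL; NOT the
tempered Frobenioid of the Tate curve `X̲̲_v`; NO [IUTchI] Ex. 3.2 (i) token».  No instance, no notation, no `Prop` fact, no sorry;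
nothing here bears on [IUTchIII] Cor. 3.12; typed ≠ inhabited ≠ proved.
-/

noncomputable section

universe u₀ v₀ u v u' v' w

open CategoryTheory Opposite

/-! ## §1 Constant re-basing of a tempered Frobenioid onto another base category -/

namespace Literature.AnabelianGeometry.EtaleTheta

open Literature.AlgebraicGeometry.Frobenioids

namespace TemperedFrobenioid

variable {D₀ : Type u₀} [Category.{v₀} D₀] {V : FrdIMonoidStub.{w}} {T : RealifiedDivisorMonoids (D₀ := D₀) V}
  {D : Type u} [Category.{v} D] {r s : (Dᵒᵖ ⥤ CommMonCat.{w}) → Prop}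
  (C : TemperedFrobenioid T D (treeCatVocab D r s)) (A₀ : D) (D' : Type u') [Category.{v'} D']

/-- The constant structure functor `D' → D₀` at the object `Y_{A₀}` under `A₀`. [cite: MochizukiEtTh2009, Def 3.6 p.77] -/
abbrev constBase : D' ⥤ D₀ := (Functor.const D').obj (C.base.obj A₀)

/-- `Φ ⊆ Φ^{ℝ-log}` over `D'` for the constant structure functor: `Φ(A') := Φ(A₀)` at every `A'` (the ambient monoid
`Φ^{ℝ-log}(A') = Φ₀^ℝ(Y_{A₀})` is constant and every pull-back is the identity). [cite: MochizukiEtTh2009, Def 3.6 p.77] -/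
def constΦ : SubMonoidOn ((C.constBase A₀ D').op ⋙ T.ΦR) where
  carrier _ := C.Φ.carrier (op A₀)
  map_mem {A B} f x hx := by
    change (T.ΦR.map (𝟙 (C.base.obj A₀)).op).hom x ∈ C.Φ.carrier (op A₀)
    rw [op_id, T.ΦR.map_id]
    exact hx

/-- The pull-back maps of the monoid `constΦ` on `D'` ([FrdI] Def. 1.1 (ii)) are the identity.
[cite: MochizukiFrdI2008, Def. 1.1(ii) p.19] -/
theorem pull_constΦ_eq_id {A B : D'} (α : B ⟶ A) :
    pull (C.constΦ A₀ D').toFunctor α = MonoidHom.id _ := by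
  apply MonoidHom.ext
  intro x
  apply Subtype.ext
  change (T.ΦR.map (𝟙 (C.base.obj A₀)).op).hom x.1 = x.1
  rw [op_id, T.ΦR.map_id]
  rfl

variable (hD' : IsConnected D') (hD'' : IsTotallyEpimorphic D') (r' s' : (D'ᵒᵖ ⥤ CommMonCat.{w}) → Prop)

/-- **Constant re-basing** (Def. 3.6 (ii) allows ANY connected, totally epimorphic `D` with a functor `D → D₀`): the tempered
Frobenioid over `D'` whose structure functor is constant at `Y_{A₀}` and whose divisor monoid is `Φ(A₀)` at every object — every
clause of Def. 3.6 (ii) is that of `C` at `A₀`; «divisorial monoid on `D'`» holds because all pull-backs are identities.  (A MODEL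
device: it forgets the geometry of `D'`.) [cite: MochizukiEtTh2009, Def 3.6 p.77] -/
def constRebase : TemperedFrobenioid T D' (treeCatVocab D' r' s') where
  isConnected := hD'
  isTotallyEpimorphic := hD''
  base := C.constBase A₀ D'
  Φ := C.constΦ A₀ D'
  isGroupSaturated _ := C.isGroupSaturated (op A₀)
  isPerfFactorial _ := C.isPerfFactorial (op A₀)
  isDivisorialOn := by
    refine ⟨⟨fun α => ?_, fun α _ => ?_⟩, fun _ => C.isDivisorialOn.2 A₀⟩
    · rw [C.pull_constΦ_eq_id A₀ D' α]
      exact isCharInjective_id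
    · rw [C.pull_constΦ_eq_id A₀ D' α]
      exact Function.bijective_id
  isMonoprime_bsFld _ := C.isMonoprime_bsFld (op A₀)
  exists_FΛ_div_ne _ := C.exists_FΛ_div_ne (op A₀)

/-- The structure functor of the constant re-basing is constant at `Y_{A₀}`. [cite: MochizukiEtTh2009, Def 3.6 p.77] -/
theorem constRebase_base_obj (A : D') : (C.constRebase A₀ D' hD' hD'' r' s').base.obj A = C.base.obj A₀ := rfl

/-- Its divisor monoid at every object is `Φ(A₀)`. [cite: MochizukiEtTh2009, Def 3.6 p.77] -/
theorem constRebase_Φ_carrier (A : D'ᵒᵖ) : (C.constRebase A₀ D' hD' hD'' r' s').Φ.carrier A = C.Φ.carrier (op A₀) := rfl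

/-- Its base-field-theoretic part at every object is `Φ^{bs-fld}(A₀)`. [cite: MochizukiEtTh2009, Def 3.6 p.77] -/
theorem constRebase_bsFld_carrier (A : D'ᵒᵖ) :
    (C.constRebase A₀ D' hD' hD'' r' s').bsFld.carrier A = C.bsFld.carrier (op A₀) := rfl

include C A₀ hD' hD'' in
/-- Non-vacuity: Def. 3.6 (ii) data over `D'` exist as soon as some tempered Frobenioid exists (over any base).
[cite: MochizukiEtTh2009, Def 3.6 p.77] -/
theorem nonempty_constRebase : Nonempty (TemperedFrobenioid T D' (treeCatVocab D' r' s')) :=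
  ⟨C.constRebase A₀ D' hD' hD'' r' s'⟩

end TemperedFrobenioid

end Literature.AnabelianGeometry.EtaleTheta

/-! ## §2 A sum of faithful functors is faithful -/

namespace Literature.AnabelianGeometry.EtaleTheta.ThetaInputOfThetaTower

/-- `F ⊕ G : A ⊕ C ⥤ B ⊕ D` is faithful when `F` and `G` are (bookkeeping for the hull functor below). [folklore] -/
private theorem sum_faithful {A : Type*} [Category A] {B : Type*} [Category B] {C : Type*} [Category C] {D : Type*}
    [Category D] (F : A ⥤ B) (G : C ⥤ D) [F.Faithful] [G.Faithful] : (F.sum G).Faithful := by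
  refine ⟨fun {X Y} f g h => ?_⟩
  induction f using Sum.homInduction with
  | inl x y f =>
    obtain ⟨g⟩ := g
    change (F.sum G).map ((Sum.inl_ A C).map f) = (F.sum G).map ((Sum.inl_ A C).map g) at h
    rw [Functor.sum_map_inl, Functor.sum_map_inl] at h
    have h' : F.map f = F.map g := congrArg ULift.down h
    exact congrArg _ (F.map_injective h')
  | inr x y f =>
    obtain ⟨g⟩ := g
    change (F.sum G).map ((Sum.inr_ A C).map f) = (F.sum G).map ((Sum.inr_ A C).map g) at h
    rw [Functor.sum_map_inr, Functor.sum_map_inr] at h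
    have h' : G.map f = G.map g := congrArg ULift.down h
    exact congrArg _ (G.map_injective h')

end Literature.AnabelianGeometry.EtaleTheta.ThetaInputOfThetaTower

/-! ## §3 The MODEL tempered side whose `ℱ̲_v`-summand is the ε-free theta tower read at one covering -/

namespace Literature.AnabelianGeometry.EtaleTheta

namespace ThetaInputOfThetaTower

open Literature.AlgebraicGeometry.Frobenioids Literature.AlgebraicGeometry.Frobenioids.PadicFrd
  Literature.AnabelianGeometry.SemiGraphs Literature.IUT.HodgeTheaters

variable {p : ℕ} [Fact p.Prime] {d : GaloisValDatum.{0} p} {P : Type} [Group P] [TopologicalSpace P]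
  (T : BadLocalGroupDatum d.Gal P) {qroot : intNonzero d.k} (hq : ¬ IsUnit qroot)
  (R S : ((CosetCat P)ᵒᵖ ⥤ CommMonCat.{0}) → Prop) (A₀ : ConnectedPart (BTemp TateTowerKummerTwistRShear.Compat₃'))

/-- **The `ℱ̲_v`-summand**: the ε-free theta tower's tempered Frobenioid (FILE 4, `ThetaTwistTowerTempered.temperedFrobenioid`)
read at the covering `A₀`, constantly re-based over `𝒟_v = CosetCat Π_v` (the vocabulary parameters of FILE 4 fixed to `⊤`).
[cite: MochizukiEtTh2009, Def 3.6 p.77] -/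
abbrev frd :=
  (ThetaTwistTowerTempered.temperedFrobenioid (fun _ => True) (fun _ => True)).constRebase A₀ (CosetCat P)
    CosetCat.isConnected CosetCat.isTotallyEpimorphic R S

/-- **The MODEL carrier `ℱ̲_v = ℱ÷_v := C_{A₀} ⊕ (𝒞⊢_v ⊕ 𝒞^Θ_v)`** (`C_{A₀}` = the model category of `frd`).
[cite: Mochizuki2012, I Ex 3.2 (i) p.70] -/
abbrev Carrier : Type := (frd R S A₀).category ⊕ (d.Cdash hq ⊕ T.CTheta d hq)

/-- **The MODEL `𝒞_v := C_{A₀}^{bs-fld} ⊕ 𝒞⊢_v`** (the REAL hull category of `frd`, plus the formal `𝒞⊢_v`-summand).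
[cite: Mochizuki2012, I Ex 3.2 (iii) p.71] -/
abbrev HullCarrier : Type := (frd R S A₀).hullCategory ⊕ d.Cdash hq

/-- The structure functor `ℱ̲_v → 𝒟_v`: the model-Frobenioid base functor on `C_{A₀}`, `𝒞⊢_v → 𝒟⊢_v ⊆ 𝒟_v`,
`𝒞^Θ_v → 𝒟^Θ_v ⊆ (𝒟_v)_{Ÿ_v} → 𝒟_v`. [cite: Mochizuki2012, I Ex 3.2 (i) p.70] -/
def toBase : Carrier T hq R S A₀ ⥤ T.Dv :=
  (frd R S A₀).baseFunctorOfCategory.sum'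
    ((d.CdashBase hq ⋙ T.incl).sum' (T.CThetaBase d hq ⋙ T.dThetaIncl ⋙ Over.forget T.ydd))

/-- `𝒞_v → ℱ̲_v`: the REAL hull functor `C_{A₀}^{bs-fld} → C_{A₀}` on the first summand, the inclusion on `𝒞⊢_v`.
[cite: Mochizuki2012, I Ex 3.2 (iii) p.71] -/
def hull : HullCarrier hq R S A₀ ⥤ Carrier T hq R S A₀ :=
  (frd R S A₀).hull.sum (Sum.inl_ (d.Cdash hq) (T.CTheta d hq))

/-- `𝒞_v → ℱ̲_v` is faithful ([EtTh] Def. 3.6 (iv) «a natural faithful functor», abc-iut-L2's `hullFaithful_holds`, ⊕ an inclusion).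
[cite: MochizukiEtTh2009, Def 3.6 p.78] -/
theorem hull_faithful : (hull T hq R S A₀).Faithful :=
  haveI : (frd R S A₀).hull.Faithful := (frd R S A₀).hullFaithful_holds
  haveI := sum_inl_faithful (d.Cdash hq) (T.CTheta d hq)
  sum_faithful _ _

/-- `𝒞^Θ_v ⊆ ℱ÷_v`: the inclusion of the third summand. [cite: Mochizuki2012, I Ex 3.2 (v) p.72] -/
def cTheta : T.CTheta d hq ⥤ Carrier T hq R S A₀ :=
  Sum.inr_ (d.Cdash hq) (T.CTheta d hq) ⋙ Sum.inr_ (frd R S A₀).category (d.Cdash hq ⊕ T.CTheta d hq)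

/-- `𝒞^Θ_v ⊆ ℱ÷_v` is faithful. [cite: Mochizuki2012, I Ex 3.2 (v) p.72] -/
theorem cTheta_faithful : (cTheta T hq R S A₀).Faithful :=
  haveI := sum_inr_faithful (d.Cdash hq) (T.CTheta d hq)
  haveI := sum_inr_faithful (frd R S A₀).category (d.Cdash hq ⊕ T.CTheta d hq)
  Functor.Faithful.comp _ _

/-- `𝒞⊢_v → 𝒞_v → ℱ̲_v → 𝒟_v` is `𝒞⊢_v → 𝒟⊢_v ⊆ 𝒟_v`. [cite: Mochizuki2012, I Ex 3.2 (iv) p.71] -/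
def cdashBaseIso :
    Sum.inr_ (frd R S A₀).hullCategory (d.Cdash hq) ⋙ hull T hq R S A₀ ⋙ toBase T hq R S A₀ ≅ d.CdashBase hq ⋙ T.incl :=
  (Functor.associator _ _ _).symm ≪≫ Functor.isoWhiskerRight (Functor.inrCompSum' _ _) _ ≪≫ Functor.associator _ _ _ ≪≫
    Functor.isoWhiskerLeft _ (Functor.inrCompSum' _ _) ≪≫ Functor.inlCompSum' _ _

/-- `𝒞^Θ_v ⊆ ℱ÷_v → 𝒟_v` is `𝒞^Θ_v → 𝒟^Θ_v ⊆ (𝒟_v)_{Ÿ_v} → 𝒟_v`. [cite: Mochizuki2012, I Ex 3.2 (v) p.72] -/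
def cThetaBaseIso : cTheta T hq R S A₀ ⋙ toBase T hq R S A₀ ≅ T.CThetaBase d hq ⋙ T.dThetaIncl ⋙ Over.forget T.ydd :=
  Functor.associator _ _ _ ≪≫ Functor.isoWhiskerLeft _ (Functor.inrCompSum' _ _) ≪≫ Functor.inrCompSum' _ _

/-- **THE MODEL TEMPERED SIDE with an [EtTh] `ℱ̲_v`-summand** — an inhabitant of abc-iut-L5-t2's INPUT interface
`TemperedThetaInput d T hq` for EVERY group datum `T`, non-unit `q̲`, vocabulary choice `R`, `S` on `𝒟_v` and covering `A₀` of
the theta tower: `T_A := inl (A, 0)` (over `A` on the nose), `birat := 𝟭`, `𝒞_v → ℱ̲_v :=` hull `⊕` inclusion,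
`𝒞⊢_v → 𝒞_v := inr`, `Θ̲_v := 1`, `𝒪^×(T^÷_Ÿ) := ⊥`, `l·ℤ := ⊥`, constants trivial.  LABEL «MODEL; no Ex. 3.2 (i) token».
[cite: Mochizuki2012, I Ex 3.2 (i) p.70] -/
def model : TemperedThetaInput d T hq (Carrier T hq R S A₀) (Carrier T hq R S A₀) (HullCarrier hq R S A₀) where
  toBase := toBase T hq R S A₀
  Tobj A := Sum.inl ⟨A, 1⟩
  Tobj_base A := Iso.refl A
  birat := 𝟭 _
  biratBase := toBase T hq R S A₀
  birat_base := ⟨(toBase T hq R S A₀).leftUnitor⟩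
  unitsTY := ⊥
  unitsTY_comm x hx y hy := by
    rw [Subgroup.mem_bot] at hx hy
    rw [hx, hy]
  theta := 1
  theta_mem := Subgroup.one_mem _
  lZ := ⊥
  constUnits := 1
  hull := hull T hq R S A₀
  hull_faithful := hull_faithful T hq R S A₀
  CdashToC := Sum.inr_ _ _
  CdashToC_faithful := sum_inr_faithful _ _
  CdashToC_base := ⟨cdashBaseIso T hq R S A₀⟩
  CThetaToBirat := cTheta T hq R S A₀
  CThetaToBirat_faithful := cTheta_faithful T hq R S A₀
  CThetaToBirat_base := ⟨cThetaBaseIso T hq R S A₀⟩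

/-! ## §4 Honesty and content -/

/-- The Frobenius-trivial object over `A` is the object `(A, 0)` of the [EtTh] model category `C_{A₀}`.
[cite: Mochizuki2012, I Ex 3.2 (i) p.70] -/
theorem model_Tobj (A : T.Dv) : (model T hq R S A₀).Tobj A = Sum.inl ⟨A, 1⟩ := rfl

/-- … and lies over `A` on the nose. [cite: Mochizuki2012, I Ex 3.2 (i) p.70] -/
theorem model_toBase_obj_Tobj (A : T.Dv) : (model T hq R S A₀).toBase.obj ((model T hq R S A₀).Tobj A) = A := rfl

/-- HONESTY: `Θ̲_v` of the model is `1` (no `Θ̈`-content: a birationalization functor is not available).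
[cite: Mochizuki2012, I Ex 3.2 (ii) p.70] -/
theorem model_theta : (model T hq R S A₀).theta = 1 := rfl

/-- HONESTY: `𝒪^×(T^÷_{Ÿ_v})` of the model is trivial. [cite: Mochizuki2012, I Ex 3.2 (ii) p.70] -/
theorem model_unitsTY : (model T hq R S A₀).unitsTY = ⊥ := rfl

/-- HONESTY: `l·ℤ` of the model is trivial. [cite: Mochizuki2012, I Ex 3.2 (ii) p.71] -/
theorem model_lZ : (model T hq R S A₀).lZ = ⊥ := rfl

/-- HONESTY: `𝒞⊢_v → 𝒞_v` is the formal summand inclusion. [cite: Mochizuki2012, I Ex 3.2 (iv) p.71] -/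
theorem model_CdashToC : (model T hq R S A₀).CdashToC = Sum.inr_ _ _ := rfl

/-- **CONTENT: at every object `A` of `𝒟_v`, the divisor monoid `Φ(A)` of the `ℱ̲_v`-summand STRICTLY contains its
base-field-theoretic part `Φ^{bs-fld}(A)`** — the class of the zero divisor of `Θ̈` on the theta tower (FILE 4's
`exists_mem_Φ_not_mem_bsFld` at the covering `A₀`); so `𝒞_v ⊊ ℱ̲_v` on the [EtTh] summand is a genuine proper hull.
[cite: MochizukiEtTh2009, Def 3.6 p.77] -/
theorem model_exists_mem_Φ_not_mem_bsFld (A : T.Dv) :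
    ∃ x ∈ (frd R S A₀).Φ.carrier (op A), x ∉ (frd R S A₀).bsFld.carrier (op A) :=
  ThetaTwistTowerTempered.exists_mem_Φ_not_mem_bsFld (fun _ => True) (fun _ => True) A₀

/-- CONTENT: the divisor monoid of the `ℱ̲_v`-summand is perfect at every object (FILE 4's `hP`). [cite: MochizukiEtTh2009, Def 4.1 p.86] -/
theorem model_isPerfect_Φ (A : T.Dv) : IsPerfect ((frd R S A₀).Φ.carrier (op A)) :=
  ThetaTwistTowerTempered.hP (fun _ => True) (fun _ => True) (op A₀)

/-- **The INPUT interface of Ex. 3.2 is inhabited with an [EtTh] Def. 3.6 (ii) `ℱ̲_v`-summand** over every group datum,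
non-unit `q̲` and covering `A₀`. [cite: Mochizuki2012, I Ex 3.2 (i) p.70] -/
theorem nonempty_model :
    Nonempty (TemperedThetaInput d T hq (Carrier T hq R S A₀) (Carrier T hq R S A₀) (HullCarrier hq R S A₀)) :=
  ⟨model T hq R S A₀⟩

end ThetaInputOfThetaTower

end Literature.AnabelianGeometry.EtaleTheta

end
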